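import Literature.Geometry.Kaehler.AnalyticSetBranchLocus
import HarnessLib

/-!
# Local analytic covers adapted to an isolating plane (towards Lelong's theorem)

A step in the proof of Lelong's theorem ([Chirka1989, §14.1 Thm.],
`Literature/Geometry/Kaehler/HolomorphicChainFacts.lean`). For an analytic set `A ∋ a` in a
complex normed space `E` and an injective linear `ι : ℂ^{m+1} → E` with `a` isolated in
`A ∩ (a + range ι)` (an isolating plane, [Chirka1989, §3.5]), linear coordinates
`Θ : E ≃ K × ℂ^{m+1}` adapted to `ι` and the local analytic cover of
`Literature/Analysis/Complex/AnalyticCover.lean` over a polydisc `ball × ball` around `Θ a`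
provide ([Chirka1989, §3.7 Thm.]):

* `Literature.Geometry.Kaehler.SCV.exists_adapted_cover` — a tube `Θ⁻¹ (ball × ball)` around `a`
  on which (a) `A` is cut out by holomorphic equations near every point, (b) the number of points
  of `A` over each base point is bounded by one constant `Kb` (the sheet number bound,
  `CoverSetup.card_rootBox_le`), (c) a holomorphic discriminant `Δ ≢ 0` on the base ball
  (`CoverSetup.exists_cover_structure`) off whose zeros (d) every point of `A` is regular of
  codimension `m + 1` (`isRegPt_of_sheets`);
* `Literature.Geometry.Kaehler.SCV.finrank_lt_of_isRegPt_of_discriminant` — **dimension drop over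
  the discriminant**: a subset `B ⊆ A` of the tube lying over `{Δ = 0}` has, at each of its
  regular points, dimension `< dim K` (a holomorphic parametrisation of `B` composed with the base
  projection has finite fibres, hence is open somewhere, `exists_map_nhds_eq_of_isolated`, while
  `Δ ≢ 0`), the input for the induction on dimension in the proof that the singular part of `A`
  is `𝓗^{2p}`-null.

## References

* E. M. Chirka, *Complex Analytic Sets*, Kluwer 1989, §3.5, §3.7 Thm., §14.1 [Chirka1989].
-/

open Metric Set Filter Function
open scoped Topology

namespace Literature.Geometry.Kaehler

namespace SCV

open Literature.Analysis.Complex.SCV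

variable {E : Type*} [NormedAddCommGroup E] [NormedSpace ℂ E] [FiniteDimensional ℂ E]

/-- **Local analytic cover adapted to an isolating plane.** Let `A ∋ a` be cut out by
holomorphic equations near `a` and let `ι : ℂ^{m+1} → E` be injective with `a` isolated in
`A ∩ (a + range ι)`. Then there are linear coordinates `Θ : E ≃ K × ℂ^{m+1}` with
`Θ (ι w) = (0, w)`, radii `ε, r > 0`, a bound `Kb` and a function `Δ` on `K` such that, writing
`Θ a = (a₁, a₂)`: (a) `A` is cut out by holomorphic equations near every point of the tube
`{(Θ x).1 ∈ B(a₁, ε), (Θ x).2 ∈ B(a₂, r)}`; (b) for every `z' ∈ B(a₁, ε)`, every finite set of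
points `x ∈ A` with `(Θ x).1 = z'`, `(Θ x).2 ∈ B̄(a₂, r)` has at most `Kb` elements; (c) `Δ` is
holomorphic on `B(a₁, ε)` and vanishes identically near no point of it; (d) every `x ∈ A` in the
tube with `Δ (Θ x).1 ≠ 0` is a regular point of `A` of codimension `m + 1`.
[cite: Chirka1989, §3.7 Thm., p. 40] -/
theorem exists_adapted_cover {A : Set E} {a : E} {m : ℕ} (hA : IsZeroSetAt A a)
    (ι : (Fin (m + 1) → ℂ) →L[ℂ] E) (hι : Injective ι)
    (hiso : ∀ᶠ w in 𝓝[≠] (0 : Fin (m + 1) → ℂ), a + ι w ∉ A) :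
    ∃ (K : Submodule ℂ E) (Θ : E ≃L[ℂ] (K × (Fin (m + 1) → ℂ))) (ε r : ℝ) (Kb : ℕ) (Δ : K → ℂ),
      (∀ w, Θ (ι w) = (0, w)) ∧ 0 < ε ∧ 0 < r ∧
      (∀ x : E, (Θ x).1 ∈ ball (Θ a).1 ε → (Θ x).2 ∈ ball (Θ a).2 r → IsZeroSetAt A x) ∧
      (∀ z' ∈ ball (Θ a).1 ε, ∀ F : Finset E,
        (∀ x ∈ F, x ∈ A ∧ (Θ x).1 = z' ∧ (Θ x).2 ∈ closedBall (Θ a).2 r) → F.card ≤ Kb) ∧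
      DifferentiableOn ℂ Δ (ball (Θ a).1 ε) ∧ (∀ z' ∈ ball (Θ a).1 ε, ¬ Δ =ᶠ[𝓝 z'] 0) ∧
      (∀ x ∈ A, (Θ x).1 ∈ ball (Θ a).1 ε → (Θ x).2 ∈ ball (Θ a).2 r → Δ (Θ x).1 ≠ 0 →
        IsRegPt A (m + 1) x) := by
  classical
  -- adapted coordinates `Θ : E ≃ K × ℂ^{m+1}` with `Θ (ι w) = (0, w)`
  obtain ⟨K, Θ, hΘι⟩ := exists_equiv_adapted ι hι
  set a₁ : K := (Θ a).1 with ha₁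
  set a₂ : Fin (m + 1) → ℂ := (Θ a).2 with ha₂
  have hΘa : Θ a = (a₁, a₂) := rfl
  -- equations of `Θ '' A` near `Θ a`
  obtain ⟨U₀, hU₀o, haU₀, N, f, hf, hZU₀⟩ := hA.image_equiv Θ
  -- isolation of `a₂` in the fibre of `Θ '' A` over `a₁`
  have hisoT : ∀ᶠ w in 𝓝[≠] a₂, f (a₁, w) ≠ 0 := by
    have hpt : ∀ w, ((a₁, w) : K × (Fin (m + 1) → ℂ)) = Θ (a + ι (w - a₂)) := by
      intro w
      rw [map_add, hΘι, hΘa, Prod.mk_add_mk, add_zero, add_sub_cancel]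
    have ht : Tendsto (fun w : Fin (m + 1) → ℂ => w - a₂) (𝓝[≠] a₂) (𝓝[≠] 0) := by
      refine tendsto_nhdsWithin_of_tendsto_nhds_of_eventually_within _ ?_ ?_
      · have : Tendsto (fun w : Fin (m + 1) → ℂ => w - a₂) (𝓝 a₂) (𝓝 (a₂ - a₂)) :=
          (continuous_id.sub continuous_const).continuousAt
        rw [sub_self] at this
        exact this.mono_left nhdsWithin_le_nhds
      · exact eventually_nhdsWithin_of_forall fun w hw h0 => hw (sub_eq_zero.1 h0)
    have hmemU₀ : ∀ᶠ w in 𝓝[≠] a₂, ((a₁, w) : K × (Fin (m + 1) → ℂ)) ∈ U₀ := by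
      have hc : Continuous fun w : Fin (m + 1) → ℂ => ((a₁, w) : K × (Fin (m + 1) → ℂ)) := by
        fun_prop
      exact nhdsWithin_le_nhds (hc.continuousAt.preimage_mem_nhds (hU₀o.mem_nhds (hΘa ▸ haU₀)))
    filter_upwards [ht.eventually hiso, hmemU₀] with w hw hwU₀ hf0
    apply hw
    have hmem : ((a₁, w) : K × (Fin (m + 1) → ℂ)) ∈ (Θ '' A) ∩ U₀ := by
      rw [hZU₀]; exact ⟨hwU₀, hf0⟩
    obtain ⟨z, hzA, hz⟩ := hmem.1
    rw [hpt w] at hz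
    exact Θ.injective hz ▸ hzA
  -- the cover set-up at `Θ a`, inside `U₀`, and its discriminant
  obtain ⟨ε, r, C, F, rr, RR, hS, hsubU₀⟩ := exists_coverSetup hU₀o hf haU₀ hisoT
  obtain ⟨Δ, hΔd, hΔne, hcov⟩ := hS.exists_cover_structure
  set P : Set (K × (Fin (m + 1) → ℂ)) := ball a₁ ε ×ˢ ball a₂ r with hP
  have hPU₀ : P ⊆ U₀ := fun x hx => hsubU₀ ⟨hx.1, ball_subset_closedBall hx.2⟩
  -- membership in `A` of points of the closed tube, read through `f`
  have hAf : ∀ x : E, Θ x ∈ U₀ → (x ∈ A ↔ f (Θ x) = 0) := by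
    intro x hxU₀
    constructor
    · intro hxA
      exact (hZU₀.subset ⟨mem_image_of_mem Θ hxA, hxU₀⟩).2
    · intro hfx
      obtain ⟨y, hyA, hy⟩ := (hZU₀.symm.subset ⟨hxU₀, hfx⟩).1
      exact Θ.injective hy ▸ hyA
  refine ⟨K, Θ, ε, r, hS.boxBound, Δ, hΘι, hS.ε_pos, hS.r_pos, ?_, ?_, hΔd, hΔne, ?_⟩
  · -- (a) equations near every point of the tube
    intro x hx1 hx2
    have hxU₀ : Θ x ∈ U₀ := hPU₀ ⟨hx1, hx2⟩
    have h1 : IsZeroSetAt (Θ '' A) (Θ x) := ⟨U₀, hU₀o, hxU₀, N, f, hf, hZU₀⟩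
    exact (isZeroSetAt_image_equiv_iff Θ).1 h1
  · -- (b) the fibre bound
    intro z' hz' Fs hFs
    have hinj : Set.InjOn (fun x : E => (Θ x).2) (Fs : Set E) := by
      intro x hx x' hx' h
      have h1 : (Θ x).1 = (Θ x').1 := by rw [(hFs x hx).2.1, (hFs x' hx').2.1]
      exact Θ.injective (Prod.ext h1 h)
    have hmaps : ∀ x ∈ Fs, (Θ x).2 ∈ rootBox F a₂ rr z' := by
      intro x hx
      obtain ⟨hxA, hx1, hx2⟩ := hFs x hx
      have hmem : Θ x ∈ ball a₁ ε ×ˢ closedBall a₂ r := ⟨by rw [mem_ball, hx1]; exact hz', hx2⟩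
      have hfx : f (Θ x) = 0 := (hAf x (hsubU₀ hmem)).1 hxA
      have := hS.mem_rootBox_of_zero hmem hfx
      rwa [hx1] at this
    calc Fs.card = (Fs.image fun x : E => (Θ x).2).card := (Finset.card_image_of_injOn hinj).symm
      _ ≤ (rootBox F a₂ rr z').card := Finset.card_le_card (Finset.image_subset_iff.2 hmaps)
      _ ≤ hS.boxBound := hS.card_rootBox_le hz'
  · -- (d) regularity off the discriminant
    intro x hxA hx1 hx2 hΔx
    set z₀ : K := (Θ x).1 with hz₀
    obtain ⟨δ, hδ, hδsub, nn, σ, hσd, hσinj, -, hσiff⟩ := hcov z₀ hx1 hΔx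
    have hfx : f (Θ x) = 0 := (hAf x (hPU₀ ⟨hx1, hx2⟩)).1 hxA
    obtain ⟨j, hj⟩ := (hσiff z₀ (mem_ball_self hδ) (Θ x).2 (ball_subset_closedBall hx2)).1
      (by rw [hz₀]; exact hfx)
    have hw₀ : σ j z₀ ∈ ball a₂ r := hj ▸ hx2
    have hreg : IsRegPt (Θ '' A) (m + 1) (z₀, σ j z₀) := by
      refine isRegPt_of_sheets hδ hσd hσinj (fun z' hz' w hw => ?_) j hw₀
      have hmemP : ((z', w) : K × (Fin (m + 1) → ℂ)) ∈ P := ⟨hδsub hz', hw⟩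
      rw [← hσiff z' hz' w (ball_subset_closedBall hw)]
      constructor
      · intro h; exact (hZU₀.subset ⟨h, hPU₀ hmemP⟩).2
      · intro h; exact (hZU₀.symm.subset ⟨hPU₀ hmemP, h⟩).1
    have hΘx : Θ x = (z₀, σ j z₀) := Prod.ext rfl hj
    have hregA : IsRegPt A (m + 1) (Θ.symm (z₀, σ j z₀)) := by
      have := hreg.image_equiv Θ.symm
      simpa [Set.image_image] using this
    rwa [← hΘx, ContinuousLinearEquiv.symm_apply_apply] at hregA


/-- **Dimension drop over the discriminant.** In the situation of `exists_adapted_cover` — linear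
coordinates `Θ : E ≃ K × ℂ^{m+1}`, a bound `Kb` on the finite sets of points of `A` over each
base point `z' ∈ B(a₁, ε)` with fibre coordinate in `B̄(a₂, r)`, a function `Δ` on
`B(a₁, ε)` vanishing identically near none of its points — let `B ⊆ A` be a set of points of
the tube lying over `{Δ = 0}`. Then at every regular point `x` of `B` of codimension `q'` one has
`dim E < q' + dim K`, i.e. `B` has dimension `< dim K` there. Otherwise `B` contains near `x` a
complex submanifold of dimension `≥ dim K` (`isGraphPointOver_of_isCompl_ker`), parametrised by an
open subset of `ℂ^{dim K}` (after restricting to an affine slice); its composition with the base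
projection has finite fibres (the fibre bound), hence is open at some point
(`exists_map_nhds_eq_of_isolated`), so `Δ` would vanish on an open subset of `B(a₁, ε)`. This is
Chirka's "`dim (A ∩ π⁻¹(σ)) < p`" for the critical values `σ`. [cite: Chirka1989, §3.7 Thm., p. 40] -/
theorem finrank_lt_of_isRegPt_of_discriminant {A B : Set E} {a : E} {m : ℕ} {K : Submodule ℂ E}
    (Θ : E ≃L[ℂ] (K × (Fin (m + 1) → ℂ))) {ε r : ℝ} {Kb : ℕ} {Δ : K → ℂ}
    (hfib : ∀ z' ∈ ball (Θ a).1 ε, ∀ F : Finset E,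
      (∀ x ∈ F, x ∈ A ∧ (Θ x).1 = z' ∧ (Θ x).2 ∈ closedBall (Θ a).2 r) → F.card ≤ Kb)
    (hΔne : ∀ z' ∈ ball (Θ a).1 ε, ¬ Δ =ᶠ[𝓝 z'] 0) (hBA : B ⊆ A)
    (hB : ∀ x ∈ B, (Θ x).1 ∈ ball (Θ a).1 ε ∧ (Θ x).2 ∈ ball (Θ a).2 r ∧ Δ (Θ x).1 = 0)
    {x : E} (hx : x ∈ B) {q' : ℕ} (hreg : IsRegPt B q' x) :
    Module.finrank ℂ E < q' + Module.finrank ℂ K := by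
  classical
  by_contra hcon
  rw [not_lt] at hcon
  obtain ⟨U, hU, hxU, g, hg, hBU, hsurj⟩ := hreg
  set n := Module.finrank ℂ E with hn
  set dk := Module.finrank ℂ K with hdk
  -- the tangent space and a graph parametrisation of `B` near `x`
  set T : Submodule ℂ E := LinearMap.ker (fderiv ℂ g x : E →ₗ[ℂ] (Fin q' → ℂ)) with hT
  set d := n - q' with hd
  have hTdim : Module.finrank ℂ T = d := by
    have h1 := finrank_ker_of_surjective (fderiv ℂ g x : E →ₗ[ℂ] (Fin q' → ℂ)) hsurj
    change Module.finrank ℂ T + q' = n at h1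
    omega
  have hdk_le : dk ≤ d := by omega
  haveI : CompleteSpace (Fin d → ℂ) := FiniteDimensional.complete ℂ _
  obtain ⟨μ, hμ, hcompl⟩ := exists_surjective_isCompl_ker T hTdim
  obtain ⟨O, hO, hxO, O', hO', hOO', σ, hσ, hμσ, hZO⟩ :=
    isGraphPointOver_of_isCompl_ker hU hxU hg hBU hx hsurj hμ hcompl
  set Q : Set (Fin d → ℂ) := O' ∩ σ ⁻¹' O with hQ
  have hQo : IsOpen Q := hσ.continuousOn.isOpen_inter_preimage hO' hO
  have hσx : σ (μ x) = x := (hZO.subset ⟨hx, hxO⟩).2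
  have hxQ : μ x ∈ Q := ⟨hOO' hxO, by rw [mem_preimage, hσx]; exact hxO⟩
  have hσB : ∀ u ∈ Q, σ u ∈ B := fun u hu => by
    have hfix : σ (μ (σ u)) = σ u := by rw [hμσ u hu.1]
    exact (hZO.symm.subset ⟨hu.2, hfix⟩).1
  have hσinj : InjOn σ Q := fun u hu u' hu' h => by
    rw [← hμσ u hu.1, ← hμσ u' hu'.1, h]
  -- an affine slice of dimension `dim K` through `μ x`
  set emb : (Fin dk → ℂ) →L[ℂ] (Fin d → ℂ) := ContinuousLinearMap.pi fun i : Fin d =>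
    if h : (i : ℕ) < dk then ContinuousLinearMap.proj (R := ℂ) (φ := fun _ : Fin dk => ℂ) ⟨i, h⟩
    else 0 with hemb
  have hemb_apply : ∀ v (j : Fin dk), emb v (Fin.castLE hdk_le j) = v j := by
    intro v j
    rw [hemb, ContinuousLinearMap.pi_apply]
    have hj : ((Fin.castLE hdk_le j : Fin d) : ℕ) < dk := by simp [j.2]
    rw [dif_pos hj]
    simp
  have hemb_inj : Injective emb := by
    intro v v' h
    funext j
    rw [← hemb_apply v j, ← hemb_apply v' j, h]
  set u₀ := μ x with hu₀
  set Q' : Set (Fin dk → ℂ) := {v | u₀ + emb v ∈ Q} with hQ'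
  have haff : Continuous fun v : Fin dk → ℂ => u₀ + emb v := continuous_const.add emb.continuous
  have hQ'o : IsOpen Q' := hQo.preimage haff
  have h0Q' : (0 : Fin dk → ℂ) ∈ Q' := by
    show u₀ + emb 0 ∈ Q
    rw [map_zero, add_zero]; exact hxQ
  set g₃ : (Fin dk → ℂ) → K := fun v => (Θ (σ (u₀ + emb v))).1 with hg₃
  have hg₃d : DifferentiableOn ℂ g₃ Q' := by
    have h1 : DifferentiableOn ℂ (fun v : Fin dk → ℂ => σ (u₀ + emb v)) Q' :=
      hσ.comp ((differentiableOn_const _).add emb.differentiableOn) fun v hv => hv.1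
    exact ((Θ : E →L[ℂ] K × (Fin (m + 1) → ℂ)).differentiableOn.comp h1 (fun _ _ => mem_univ _)).fst
  have hg₃mem : ∀ v ∈ Q', g₃ v ∈ ball (Θ a).1 ε := fun v hv => (hB _ (hσB _ hv)).1
  have hg₃Δ : ∀ v ∈ Q', Δ (g₃ v) = 0 := fun v hv => (hB _ (hσB _ hv)).2.2
  -- `g₃` has finite, hence isolated, fibres
  have hiso : ∀ v ∈ Q', ∀ᶠ v' in 𝓝[≠] v, g₃ v' ≠ g₃ v := by
    intro v hv
    set Bad : Set (Fin dk → ℂ) := {v' | v' ∈ Q' ∧ g₃ v' = g₃ v} with hBad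
    have hBadf : Bad.Finite := by
      by_contra hinf
      obtain ⟨Fs, hFs, hcard⟩ := Set.Infinite.exists_subset_card_eq hinf (Kb + 1)
      have hinj' : Set.InjOn (fun v' : Fin dk → ℂ => σ (u₀ + emb v')) (Fs : Set (Fin dk → ℂ)) := by
        intro v₁ hv₁ v₂ hv₂ h
        have h1 := hσinj (hFs hv₁).1 (hFs hv₂).1 h
        exact hemb_inj (add_left_cancel h1)
      have hle : (Fs.image fun v' : Fin dk → ℂ => σ (u₀ + emb v')).card ≤ Kb := by
        refine hfib (g₃ v) (hg₃mem v hv) _ fun y hy => ?_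
        obtain ⟨v', hv', rfl⟩ := Finset.mem_image.1 hy
        obtain ⟨hv'Q, hv'g⟩ := hFs (Finset.mem_coe.2 hv')
        refine ⟨hBA (hσB _ hv'Q), hv'g, ball_subset_closedBall (hB _ (hσB _ hv'Q)).2.1⟩
      rw [Finset.card_image_of_injOn hinj'] at hle
      omega
    have h1 : ∀ᶠ v' in 𝓝 v, v' ∉ Bad \ {v} :=
      (hBadf.subset sdiff_subset).isClosed.isOpen_compl.mem_nhds fun h => h.2 rfl
    rw [eventually_nhdsWithin_iff]
    filter_upwards [h1, hQ'o.mem_nhds hv] with v' hv' hv'Q hne heq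
    exact hv' ⟨⟨hv'Q, heq⟩, hne⟩
  -- so it is open at some point, and `Δ` vanishes near the image of that point
  obtain ⟨v, hvQ', hmap⟩ := exists_map_nhds_eq_of_isolated (X := Fin dk → ℂ) (F := K)
    (by simp [hdk]) hQ'o ⟨0, h0Q'⟩ hg₃d hiso
  have himage : g₃ '' Q' ∈ 𝓝 (g₃ v) := by
    rw [← hmap]; exact image_mem_map (hQ'o.mem_nhds hvQ')
  have hΔ0 : Δ =ᶠ[𝓝 (g₃ v)] 0 := by
    filter_upwards [himage] with z hz
    obtain ⟨v', hv', rfl⟩ := hz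
    exact hg₃Δ v' hv'
  exact hΔne (g₃ v) (hg₃mem v hvQ') hΔ0

end SCV

end Literature.Geometry.Kaehler
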